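import Mathlib
import HarnessLib
import Literature.Analysis.SpecialFunctions.LogChooseStirling
import Summits.KontsevichZagierPeriods.Zeta5Search.Denom.TwoTaleL720Forms
import Summits.KontsevichZagierPeriods.Zeta5Search.TwoTaleP15GrowthLimit
import Summits.KontsevichZagierPeriods.Zeta5Search.TwoTaleL720Growth
import Summits.KontsevichZagierPeriods.Zeta5Search.TwoTaleWhippleL720

/-!
# TwoTaleL720GrowthLimit — `log (qhatL720 n) / n → C₁*` and `CoeffRateL720 C₁*` from Whipple, at RUNG L(7/20)

HONEST FRAMING: systematic search; no irrationality claim unless certified.  Cell pub-zeta5 (measure-opt g0), the L(7/20) port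
of `TwoTaleL25GrowthLimit` / P1's `TwoTaleD1GrowthLimit` (file T7b).  Sequel of `TwoTaleL720Growth` (one development, split for the
400-line cap).  THIS PART:
* the LOWER bound at the near-critical index `k_n = ⌊ustarL720·n⌋` (`exp_le_termL720_kcrit`: the tree's Stirling bound
  `log_choose_ge_entropy` plus `KL ≤ χ²`, via `TwoTaleP15Growth.exp_le_choose`, turns the entropy into the affine
  Chernoff form minus the bounded penalty `penPL720 + 2·log(287n) + 8`);
* **`tendsto_log_qhatL720_div`** (PROVED, unconditional): `log (qhatL720 n) / n → C₁starL720`;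
* `coeffRateL720_of_whipple : (∀ n ≥ 1, formQL720 n = −qhatL720 n) → CoeffRateL720 C₁starL720`, **`C₁starL720_pos`**
  (`C(4n,2n) ≤ qhatL720 n`);
* the Whipple bridge: `coefATZ_aTL720`, `formQTZ_aTL720_eq_qhatL720` (Zudilin's `A_k` at the partner IS `termL720` — with sign `+1` at this rung —, the tail
  `234n+2 ≤ k` vanishes), **`whippleL720 : ∀ n ≥ 1, formQL720 n = −qhatL720 n`** (from
  `TwoTaleWhippleL720.formQL720_eq_neg_formQTZ`) and **`coeffRateL720_holds : CoeffRateL720 C₁starL720`** — the growth input of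
  L(7/20) is a THEOREM.
The enclosure `C₁starL720 ≤ 406.88613` is `TwoTaleL720GrowthEnclosure`; the measure assembly is `TwoTaleL720Measure`.
Nothing here certifies a measure; no irrationality content.
References: W. N. Bailey, Generalized hypergeometric series (1935) §4.5; W. Zudilin, arXiv:1310.1526 [Zudilin2014ZetaTwo]
§6, Remark 5.
-/

noncomputable section

open Filter Topology Finset Real

namespace Summit.KontsevichZagierPeriods.Zeta5Search.TwoTaleL720Growth

open Summit.KontsevichZagierPeriods.Zeta5Search.Denom.TwoTaleL720Forms (formQL720 CoeffRateL720)
open Summit.KontsevichZagierPeriods.Zeta5Search.TwoTaleP15Growth (choose_le_exp exp_le_choose prod4_le pen_le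
  tendsto_log_linear_div)

/-! ### Lower bound for `qhatL720` at the near-critical index -/

/-- The near-critical index `k_n = ⌊u*·n⌋`. -/
def kcritL720 (n : ℕ) : ℕ := ⌊ustarL720 * n⌋₊

/-- `k_n ≤ u*·n < k_n + 1`. -/
theorem kcritL720_real (n : ℕ) : (kcritL720 n : ℝ) ≤ ustarL720 * n ∧ ustarL720 * n < kcritL720 n + 1 :=
  ⟨Nat.floor_le (by have := ustarL720_bounds.1; positivity), Nat.lt_floor_add_one _⟩

/-- `190n ≤ k_n < 217n` for `n ≥ 1` (from `381/2 ≤ u* ≤ 216`). -/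
theorem kcritL720_range {n : ℕ} (hn : 1 ≤ n) : 190 * n ≤ kcritL720 n ∧ kcritL720 n < 217 * n := by
  have h1 := ustarL720_spec.1.1
  have h2 := ustarL720_spec.1.2
  have hn' : (1:ℝ) ≤ n := by exact_mod_cast hn
  constructor
  · apply Nat.le_floor
    push_cast
    nlinarith
  · unfold kcritL720
    rw [Nat.floor_lt (by positivity)]
    push_cast
    nlinarith

/-- **Lower half**: the single summand at `k_n = ⌊u* n⌋` is within a bounded-times-polynomial factor of the tangent
plane: `exp(n·C₁* + K₀(u*) − P − 2·log(287n) − 8) ≤ termL720 n k_n` for `n ≥ 1`. -/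
theorem exp_le_termL720_kcrit {n : ℕ} (hn : 1 ≤ n) :
    Real.exp (n * C₁starL720 + constKL720 ustarL720 - penPL720 - 2 * Real.log (287 * n) - 8) ≤ (termL720 n (kcritL720 n) : ℝ) := by
  obtain ⟨h28, h35⟩ := kcritL720_range hn
  obtain ⟨hx0, hx1⟩ := kcritL720_real n
  obtain ⟨hu1, hu2⟩ := ustarL720_bounds
  have h9u := ustarL720_spec.1.1
  have hG := ustarL720_spec.2
  obtain ⟨⟨a0, b0⟩, ⟨a1, b1⟩, ⟨a2, b2⟩, ⟨a3, b3⟩⟩ := slopes_mem hu1 hu2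
  set K := kcritL720 n with hKdef
  have hn' : (1:ℝ) ≤ n := by exact_mod_cast hn
  have hKR : (190:ℝ) * n ≤ K := by exact_mod_cast h28
  have hKR' : (K:ℝ) < 217 * n := by exact_mod_cast h35
  -- the four reverse-Chernoff bounds
  have g0 := exp_le_choose (N := 2 * K - (147 * n + 2)) (K := 167 * n) (by omega) (by omega) a0 b0
  have g1 := exp_le_choose (N := K - (60 * n + 1)) (K := 47 * n) (by omega) (by omega) a1 b1
  have g2 := exp_le_choose (N := 107 * n) (K := K - (127 * n + 1)) (by omega) (by omega) a2 b2
  have g3 := exp_le_choose (N := 107 * n) (K := K - (147 * n + 1)) (by omega) (by omega) a3 b3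
  have e0 : ((2 * K - (147 * n + 2) : ℕ) : ℝ) = 2 * K - 147 * n - 2 := by
    rw [Nat.cast_sub (by omega)]; push_cast; ring
  have e1 : ((K - (60 * n + 1) : ℕ) : ℝ) = K - 60 * n - 1 := by
    rw [Nat.cast_sub (by omega)]; push_cast; ring
  have e2 : ((K - (127 * n + 1) : ℕ) : ℝ) = K - 127 * n - 1 := by
    rw [Nat.cast_sub (by omega)]; push_cast; ring
  have e3 : ((K - (147 * n + 1) : ℕ) : ℝ) = K - 147 * n - 1 := by
    rw [Nat.cast_sub (by omega)]; push_cast; ring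
  rw [e0] at g0; rw [e1] at g1; rw [e2] at g2; rw [e3] at g3
  push_cast at g0 g1 g2 g3
  -- penalties are bounded
  have p0 : ((167 * n : ℝ) - σ₀ ustarL720 * (2 * K - 147 * n - 2)) ^ 2 / ((2 * K - 147 * n - 2) * (σ₀ ustarL720 * (1 - σ₀ ustarL720)))
      ≤ 9 / (σ₀ ustarL720 * (1 - σ₀ ustarL720)) := by
    refine pen_le (by linarith) a0 b0 ?_
    have h7 : (0:ℝ) < 2 * ustarL720 - 147 := by linarith
    have e : (167 * n : ℝ) - σ₀ ustarL720 * (2 * K - 147 * n - 2) = 167 * (2 * (ustarL720 * n - K) + 2) / (2 * ustarL720 - 147) := by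
      unfold σ₀; field_simp; ring
    rw [e]
    have hx : 0 ≤ 167 * (2 * (ustarL720 * n - K) + 2) / (2 * ustarL720 - 147) := div_nonneg (by linarith) h7.le
    have hx' : 167 * (2 * (ustarL720 * n - K) + 2) / (2 * ustarL720 - 147) ≤ 3 := by
      rw [div_le_iff₀ h7]; linarith
    exact (pow_le_pow_left₀ hx hx' 2).trans (by norm_num)
  have p1 : ((47 * n : ℝ) - σ₁ ustarL720 * (K - 60 * n - 1)) ^ 2 / ((K - 60 * n - 1) * (σ₁ ustarL720 * (1 - σ₁ ustarL720)))
      ≤ 1 / (σ₁ ustarL720 * (1 - σ₁ ustarL720)) := by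
    refine pen_le (by linarith) a1 b1 ?_
    have h3 : (0:ℝ) < ustarL720 - 60 := by linarith
    have e : (47 * n : ℝ) - σ₁ ustarL720 * (K - 60 * n - 1) = 47 * ((ustarL720 * n - K) + 1) / (ustarL720 - 60) := by
      unfold σ₁; field_simp; ring
    rw [e]
    have hx : 0 ≤ 47 * ((ustarL720 * n - K) + 1) / (ustarL720 - 60) := div_nonneg (by linarith) h3.le
    have hx' : 47 * ((ustarL720 * n - K) + 1) / (ustarL720 - 60) ≤ 1 := by
      rw [div_le_iff₀ h3]; linarith
    exact (pow_le_pow_left₀ hx hx' 2).trans (by norm_num)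
  have p2 : ((K - 127 * n - 1 : ℝ) - σ₂ ustarL720 * (107 * n)) ^ 2 / ((107 * n) * (σ₂ ustarL720 * (1 - σ₂ ustarL720)))
      ≤ 4 / (σ₂ ustarL720 * (1 - σ₂ ustarL720)) := by
    refine pen_le (by linarith) a2 b2 ?_
    have e : (K - 127 * n - 1 : ℝ) - σ₂ ustarL720 * (107 * n) = (K - ustarL720 * n) - 1 := by
      unfold σ₂; field_simp; ring
    rw [e]
    have hx : (K - ustarL720 * n : ℝ) - 1 ≤ 2 := by linarith
    have hx' : -2 ≤ (K - ustarL720 * n : ℝ) - 1 := by linarith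
    exact (sq_le_sq' hx' hx).trans (by norm_num)
  have p3 : ((K - 147 * n - 1 : ℝ) - σ₃ ustarL720 * (107 * n)) ^ 2 / ((107 * n) * (σ₃ ustarL720 * (1 - σ₃ ustarL720)))
      ≤ 4 / (σ₃ ustarL720 * (1 - σ₃ ustarL720)) := by
    refine pen_le (by linarith) a3 b3 ?_
    have e : (K - 147 * n - 1 : ℝ) - σ₃ ustarL720 * (107 * n) = (K - ustarL720 * n) - 1 := by
      unfold σ₃; field_simp; ring
    rw [e]
    have hx : (K - ustarL720 * n : ℝ) - 1 ≤ 2 := by linarith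
    have hx' : -2 ≤ (K - ustarL720 * n : ℝ) - 1 := by linarith
    exact (sq_le_sq' hx' hx).trans (by norm_num)
  -- logarithms of the block sizes
  have hl : ∀ x : ℝ, 1 ≤ x → x ≤ 287 * n → Real.log x ≤ Real.log (287 * n) := fun x hx hx' =>
    Real.log_le_log (by linarith) hx'
  have l0 := hl (2 * K - 147 * n - 2) (by linarith) (by linarith)
  have l1 := hl (K - 60 * n - 1) (by linarith) (by linarith)
  have l2 := hl (107 * n) (by linarith) (by linarith)
  -- assemble
  have hsum := affine_eq ustarL720 (n : ℝ) (K : ℝ)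
  rw [hG, mul_zero, add_zero] at hsum
  have hprod := prod4_le (Real.exp_pos _).le (Real.exp_pos _).le (Real.exp_pos _).le (Real.exp_pos _).le g0 g1 g2 g3
  rw [← Real.exp_add, ← Real.exp_add, ← Real.exp_add] at hprod
  have hcast : (termL720 n K : ℝ) = ((2 * K - (147 * n + 2)).choose (167 * n) : ℝ) * ((K - (60 * n + 1)).choose (47 * n) : ℝ) *
      ((107 * n).choose (K - (127 * n + 1)) : ℝ) * ((107 * n).choose (K - (147 * n + 1)) : ℝ) := by
    unfold termL720; push_cast; ring
  rw [hcast]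
  refine le_trans (Real.exp_le_exp.mpr ?_) hprod
  unfold C₁starL720 penPL720
  linarith [hsum, p0, p1, p2, p3, l0, l1, l2]

/-- `qhatL720 n` dominates the near-critical summand (`n ≥ 1`). -/
theorem termL720_kcrit_le_qhatL720 {n : ℕ} (hn : 1 ≤ n) : termL720 n (kcritL720 n) ≤ qhatL720 n := by
  obtain ⟨h28, h35⟩ := kcritL720_range hn
  unfold qhatL720
  exact Finset.single_le_sum (f := fun k => termL720 n k) (fun _ _ => Nat.zero_le _)
    (Finset.mem_Ico.mpr ⟨by omega, by omega⟩)

/-- **Two-sided bounds** for `log (qhatL720 n)`, `n ≥ 1`. -/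
theorem log_qhatL720_bounds {n : ℕ} (hn : 1 ≤ n) :
    n * C₁starL720 + constKL720 ustarL720 - penPL720 - 2 * Real.log (287 * n) - 8 ≤ Real.log (qhatL720 n) ∧
      Real.log (qhatL720 n) ≤ n * C₁starL720 + constKL720 ustarL720 + Real.log (107 * n + 1) := by
  have hlo := (exp_le_termL720_kcrit hn).trans (by exact_mod_cast termL720_kcrit_le_qhatL720 hn :
    (termL720 n (kcritL720 n) : ℝ) ≤ qhatL720 n)
  have hq : (0 : ℝ) < qhatL720 n := (Real.exp_pos _).trans_le hlo
  constructor
  · have := Real.log_le_log (Real.exp_pos _) hlo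
    rwa [Real.log_exp] at this
  · have h := Real.log_le_log hq (qhatL720_le n)
    have hpos : (0:ℝ) < 107 * n + 1 := by positivity
    rw [Real.log_mul hpos.ne' (Real.exp_pos _).ne', Real.log_exp] at h
    linarith

/-! ### The limit -/

/-- **THE COEFFICIENT RATE EXISTS (unconditionally, for the partner sum):** `log (qhatL720 n) / n → C₁*`. -/
theorem tendsto_log_qhatL720_div : Tendsto (fun n : ℕ => Real.log (qhatL720 n) / n) atTop (𝓝 C₁starL720) := by
  have hA : Tendsto (fun n : ℕ => (constKL720 ustarL720 - penPL720 - 8) / (n : ℝ)) atTop (𝓝 0) :=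
    tendsto_const_div_atTop_nhds_zero_nat _
  have hB : Tendsto (fun n : ℕ => Real.log (287 * n + 0) / (n : ℝ)) atTop (𝓝 0) :=
    tendsto_log_linear_div (by norm_num) le_rfl
  have hC : Tendsto (fun n : ℕ => (constKL720 ustarL720) / (n : ℝ)) atTop (𝓝 0) :=
    tendsto_const_div_atTop_nhds_zero_nat _
  have hD : Tendsto (fun n : ℕ => Real.log (107 * n + 1) / (n : ℝ)) atTop (𝓝 0) :=
    tendsto_log_linear_div (by norm_num) (by norm_num)
  have hlo : Tendsto (fun n : ℕ => C₁starL720 + ((constKL720 ustarL720 - penPL720 - 8) / (n : ℝ) - 2 * (Real.log (287 * n + 0) / n)))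
      atTop (𝓝 C₁starL720) := by
    simpa using tendsto_const_nhds.add (hA.sub (hB.const_mul 2))
  have hhi : Tendsto (fun n : ℕ => C₁starL720 + ((constKL720 ustarL720) / (n : ℝ) + Real.log (107 * n + 1) / n))
      atTop (𝓝 C₁starL720) := by
    simpa using tendsto_const_nhds.add (hC.add hD)
  refine tendsto_of_tendsto_of_tendsto_of_le_of_le' hlo hhi ?_ ?_
  · filter_upwards [eventually_ge_atTop 1] with n hn
    have hnpos : (0:ℝ) < n := by exact_mod_cast hn
    have h := (log_qhatL720_bounds hn).1
    rw [add_zero]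
    have e : C₁starL720 + ((constKL720 ustarL720 - penPL720 - 8) / (n : ℝ) - 2 * (Real.log (287 * n) / n)) =
        (n * C₁starL720 + constKL720 ustarL720 - penPL720 - 2 * Real.log (287 * n) - 8) / n := by
      field_simp; ring
    rw [e]
    exact div_le_div_of_nonneg_right h hnpos.le
  · filter_upwards [eventually_ge_atTop 1] with n hn
    have hnpos : (0:ℝ) < n := by exact_mod_cast hn
    have h := (log_qhatL720_bounds hn).2
    have e : C₁starL720 + ((constKL720 ustarL720) / (n : ℝ) + Real.log (107 * n + 1) / n) =
        (n * C₁starL720 + constKL720 ustarL720 + Real.log (107 * n + 1)) / n := by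
      field_simp; ring
    rw [e]
    exact div_le_div_of_nonneg_right h hnpos.le

/-- **`CoeffRateL720 C₁*` from Whipple** (`q_n = −q̂_n` at L(7/20), proved in `TwoTaleWhippleL720`). -/
theorem coeffRateL720_of_whipple (hW : ∀ n : ℕ, 1 ≤ n → formQL720 n = -((qhatL720 n : ℕ) : ℤ)) :
    CoeffRateL720 C₁starL720 := by
  unfold CoeffRateL720
  refine tendsto_log_qhatL720_div.congr' ?_
  filter_upwards [eventually_ge_atTop 1] with n hn
  rw [hW n hn]
  push_cast
  rw [abs_neg, abs_of_nonneg (Nat.cast_nonneg _)]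

/-! ### Positivity of the rate -/

/-- A crude lower bound: `4^{2n} ≤ (4n+1)·qhatL720 n` (the summand at `k = 180n+1` contains `C(107n, 53n) ≥ C(4n, 2n)`). -/
theorem four_pow_le_qhatL720 {n : ℕ} (hn : 1 ≤ n) : 4 ^ (2 * n) ≤ (4 * n + 1) * qhatL720 n := by
  have hk : termL720 n (180 * n + 1) ≤ qhatL720 n := by
    unfold qhatL720
    exact Finset.single_le_sum (f := fun k => termL720 n k) (fun _ _ => Nat.zero_le _)
      (Finset.mem_Ico.mpr ⟨by omega, by omega⟩)
  have hA : Nat.centralBinom (2 * n) ≤ termL720 n (180 * n + 1) := by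
    unfold termL720
    have e1 : 2 * (180 * n + 1) - (147 * n + 2) = 213 * n := by omega
    have e2 : 180 * n + 1 - (60 * n + 1) = 120 * n := by omega
    have e3 : 180 * n + 1 - (127 * n + 1) = 53 * n := by omega
    have e4 : 180 * n + 1 - (147 * n + 1) = 33 * n := by omega
    rw [e1, e2, e3, e4, Nat.centralBinom_eq_two_mul_choose, show 2 * (2 * n) = 4 * n by ring]
    have h1 : 1 ≤ (213 * n).choose (167 * n) := Nat.choose_pos (by omega)
    have h2a : (4 * n).choose (2 * n) ≤ (106 * n).choose (2 * n) := Nat.choose_le_choose (2 * n) (by omega)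
    have h2b : (106 * n).choose (2 * n) ≤ (106 * n).choose (53 * n) := by
      have := Nat.choose_le_middle (2 * n) (106 * n)
      rwa [show 106 * n / 2 = 53 * n by omega] at this
    have h2c : (106 * n).choose (53 * n) ≤ (107 * n).choose (53 * n) := Nat.choose_le_choose (53 * n) (by omega)
    have h2 : (4 * n).choose (2 * n) ≤ (107 * n).choose (53 * n) := (h2a.trans h2b).trans h2c
    have h3 : 1 ≤ (120 * n).choose (47 * n) := Nat.choose_pos (by omega)
    have h4 : 1 ≤ (107 * n).choose (33 * n) := Nat.choose_pos (by omega)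
    calc (4 * n).choose (2 * n) = 1 * 1 * (4 * n).choose (2 * n) * 1 := by ring
      _ ≤ (213 * n).choose (167 * n) * (120 * n).choose (47 * n) * (107 * n).choose (53 * n) * (107 * n).choose (33 * n) := by
          gcongr
  have hc := Nat.four_pow_le_two_mul_self_mul_centralBinom (2 * n) (by omega)
  calc 4 ^ (2 * n) ≤ 2 * (2 * n) * Nat.centralBinom (2 * n) := hc
    _ ≤ (4 * n + 1) * qhatL720 n := by
        rw [show 2 * (2 * n) = 4 * n by ring]
        exact Nat.mul_le_mul (by omega) (hA.trans hk)

/-- **`C₁* > 0`** (indeed `C₁* ≥ 2 log 4`). -/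
theorem C₁starL720_pos : 0 < C₁starL720 := by
  have hlow : Tendsto (fun n : ℕ => 2 * Real.log 4 - Real.log (4 * n + 1) / n) atTop (𝓝 (2 * Real.log 4)) := by
    simpa using tendsto_const_nhds.sub (tendsto_log_linear_div (a := 4) (b := 1) (by norm_num) (by norm_num))
  have hle : 2 * Real.log 4 ≤ C₁starL720 := by
    refine le_of_tendsto_of_tendsto hlow tendsto_log_qhatL720_div ?_
    filter_upwards [eventually_ge_atTop 1] with n hn
    have h := four_pow_le_qhatL720 hn
    have hq : 0 < qhatL720 n := by
      rcases Nat.eq_zero_or_pos (qhatL720 n) with h0 | h0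
      · rw [h0, mul_zero] at h
        have := Nat.one_le_pow (2 * n) 4 (by norm_num)
        omega
      · exact h0
    have hR : (4:ℝ) ^ (2 * n) ≤ (4 * n + 1) * (qhatL720 n : ℝ) := by exact_mod_cast h
    have hq' : (0:ℝ) < qhatL720 n := by exact_mod_cast hq
    have hlog := Real.log_le_log (by positivity) hR
    rw [Real.log_pow, Real.log_mul (by positivity) hq'.ne'] at hlog
    have hnpos : (0:ℝ) < n := by exact_mod_cast hn
    push_cast at hlog
    rw [sub_le_iff_le_add, ← add_div, le_div_iff₀ hnpos]
    linarith
  exact lt_of_lt_of_le (mul_pos (by norm_num) (Real.log_pos (by norm_num))) hle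

/-! ### The Whipple bridge: `formQTZ (â, b̂) = qhatL720`, hence `CoeffRateL720 C₁*` PROVED -/

section WhippleBridge

open Literature.NumberTheory.Irrationality.Zudilin2014
open Summit.KontsevichZagierPeriods.Zeta5Search.TwoTaleWhipple (sum_Ico_natCast)
open Summit.KontsevichZagierPeriods.Zeta5Search.TwoTaleWhippleL720
open Summit.KontsevichZagierPeriods.Zeta5Search.Denom.TwoTaleL720Forms

/-- Termwise at L(7/20): `coefATZ (aTL720 n) (bTL720 n) k = termL720 n k` on the window `k ≥ 147n+1` (at this rung the
sign exponent `167n + 47n + (k−127n−1) + (k−147n−1) = 2(k−30n−1)` is EVEN, unlike D1/L(2/5) where it is `n` mod 2). -/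
theorem coefATZ_aTL720 (n k : ℕ) (hk : 147 * n + 1 ≤ k) :
    coefATZ (aTL720 n) (bTL720 n) (k : ℤ) = (termL720 n k : ℤ) := by
  unfold coefATZ termL720
  have h0 : (2 * (k : ℤ) - bTL720 n 0).toNat = 2 * k - (147 * n + 2) := by simp; omega
  have h1 : (aTL720 n 0 - bTL720 n 0).toNat = 167 * n := by simp; omega
  have h2 : ((k : ℤ) - bTL720 n 1).toNat = k - (60 * n + 1) := by simp; omega
  have h3 : (aTL720 n 1 - bTL720 n 1).toNat = 47 * n := by simp; omega
  have h4 : (bTL720 n 2 - aTL720 n 2 - 1).toNat = 107 * n := by simp; omega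
  have h5 : ((k : ℤ) - aTL720 n 2).toNat = k - (127 * n + 1) := by simp; omega
  have h6 : (bTL720 n 3 - aTL720 n 3 - 1).toNat = 107 * n := by simp; omega
  have h7 : ((k : ℤ) - aTL720 n 3).toNat = k - (147 * n + 1) := by simp; omega
  rw [h0, h1, h2, h3, h4, h5, h6, h7]
  split_ifs with hlt
  · simp only [aTL720_zero] at hlt
    rw [Nat.choose_eq_zero_of_lt (by omega : 2 * k - (147 * n + 2) < 167 * n)]
    simp
  · simp only [aTL720_zero, not_lt] at hlt
    have hex : 167 * n + 47 * n + (k - (127 * n + 1)) + (k - (147 * n + 1)) = 2 * (k - 30 * n - 1) := by omega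
    rw [hex, pow_mul, neg_one_sq, one_pow]
    push_cast
    ring

/-- **Bridge at L(7/20)**: `formQTZ (aTL720 n) (bTL720 n) = qhatL720 n` (all `n`; the global sign `(−1)^{b̂₂+b̂₃}` is `+1`
here since `b̂₂ + b̂₃ = 488n + 4` is even). -/
theorem formQTZ_aTL720_eq_qhatL720 (n : ℕ) : formQTZ (aTL720 n) (bTL720 n) = (qhatL720 n : ℤ) := by
  unfold formQTZ qhatL720
  rw [(rangeL720_eq n).1, (rangeL720_eq n).2]
  have hsign : (-1 : ℤ) ^ (bTL720 n 2 + bTL720 n 3).natAbs = 1 := by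
    have : (bTL720 n 2 + bTL720 n 3).natAbs = 2 * (244 * n + 2) := by simp; omega
    rw [this, pow_mul, neg_one_sq, one_pow]
  rw [hsign, one_mul, show (147 * (n : ℤ) + 1 : ℤ) = ((147 * n + 1 : ℕ) : ℤ) by push_cast; ring,
    show (234 * (n : ℤ) + 2 : ℤ) = ((234 * n + 2 : ℕ) : ℤ) by push_cast; ring, sum_Ico_natCast,
    ← Finset.sum_Ico_consecutive _ (show 147 * n + 1 ≤ 234 * n + 2 by omega)
      (show 234 * n + 2 ≤ 254 * n + 2 by omega)]
  have htail : ∑ k ∈ Ico (234 * n + 2) (254 * n + 2), termL720 n k = 0 := by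
    refine Finset.sum_eq_zero fun k hk => ?_
    rw [Finset.mem_Ico] at hk
    unfold termL720
    rw [Nat.choose_eq_zero_of_lt (by omega : 107 * n < k - (127 * n + 1))]
    ring
  rw [htail, add_zero]
  push_cast
  refine Finset.sum_congr rfl fun k hk => ?_
  exact coefATZ_aTL720 n k (by rw [Finset.mem_Ico] at hk; omega)

/-- **Whipple at L(7/20), PROVED**: `q_n = −q̂_n`, i.e. `formQL720 n = −qhatL720 n` for every `n ≥ 1`. -/
theorem whippleL720 : ∀ n : ℕ, 1 ≤ n → formQL720 n = -((qhatL720 n : ℕ) : ℤ) := by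
  intro n hn
  rw [formQL720_eq_neg_formQTZ hn, formQTZ_aTL720_eq_qhatL720]

/-- **`CoeffRateL720 C₁starL720` PROVED** (`(1/n) log |q_n| → C₁* = 406.88612…`, `TwoTaleL720GrowthEnclosure.C₁starL720_le :
C₁* ≤ 406.88613`). -/
theorem coeffRateL720_holds : CoeffRateL720 C₁starL720 := coeffRateL720_of_whipple whippleL720

end WhippleBridge

end Summit.KontsevichZagierPeriods.Zeta5Search.TwoTaleL720Growth

end
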